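import Mathlib
import Literature.NumberTheory.Transcendental.KZCalculusProofs
import Summits.KontsevichZagierPeriods.KontsevichZagierPeriods.Theorems.SoloInformedVolumeCrux
import Summits.KontsevichZagierPeriods.KontsevichZagierPeriods.Theorems.SoloInformedKZUnitCube
import HarnessLib
import HarnessLib.Audit

/-!
# SoloInformed — the Ayoub transfer consumes presentability of RATIONAL representations only

Solo programme `solo-KontsevichZagierPeriods-informed`, session s109.  The conditional bridge of
the programme, `soloInformed_ayoubTransferQ : SoloInformedAyoubCubeResolution →
SoloInformedAyoubKZeffQ → KontsevichZagierPeriods` (and its cube form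
`soloInformed_ayoubTransfer₅`, file `SoloInformedCubeCrux`), asks for a presentation (by cube
integrals of cube germs, up to a positive multiple) of EVERY integral representation.  The proof of the transfer
(`soloInformed_ayoubTransferQ`) discards the two `IsRational` hypotheses of the summit: what it
actually uses is a presentation of the two GIVEN representations, which have KZ's literal shape
(integrand `p/q`, `p, q ∈ ℚ[x]`, `q ≠ 0` on the `ℚ`-semialgebraic domain).  This file records the
sharper bookkeeping and the resulting dimensionwise ladder:

* `SoloInformedPresRat n` — every RATIONAL representation of dimension `n` is presentable
  (`KZ.of r ∈ soloInformedPresentable`); `SoloInformedPresAll n` — every representation of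
  dimension `n` is; `SoloInformedCubeDim n` — every representation on the unit cube `[0,1]ⁿ` is
  (the dimension-`n` slice of the cube crux `SoloInformedAyoubCubeResolutionCube`);
* `soloInformed_equivalent_of_presentable` — two presentable representations with the same value
  are KZ-equivalent, given Ayoub's conjecture up to torsion (the two-representation core of the
  transfer);
* `soloInformed_ayoubTransferRat : (∀ n, SoloInformedPresRat n) → SoloInformedAyoubKZeffQ →
  KontsevichZagierPeriods`, and its truncation `soloInformed_kzpUpTo_of_presRat` to
  representations of dimension `≤ N` (`SoloInformedKZPUpTo N`; the summit is `∀ N`, by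
  `soloInformed_kzp_iff_forall_kzpUpTo`);
* the ladder `SoloInformedCubeDim n ↔ SoloInformedPresAll n → SoloInformedPresRat n` (THEOREM B′,
  `soloInformed_kzUnitCube`) and `SoloInformedPresRat (n + 1) → SoloInformedPresAll n` (the
  volume-under-the-graph representation `KZ.IntegralRep.graphRep` is rational, one dimension up);
  hence `(∀ n, SoloInformedPresRat n) ↔ SoloInformedAyoubCubeResolution`
  (`soloInformed_forall_presRat_iff_cubeResolution`): globally nothing is lost or gained, but
  dimension by dimension `SoloInformedPresRat n` is the weaker and the relevant statement.

References: J. Ayoub, EMS Newsl. 91 (2014), §2.2, Conj. 7, Prop. 11, Rem. 13; M. Kontsevich,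
D. Zagier, *Periods* (2001), §1.1 (remark after the Definition), §1.2.
-/

open scoped BigOperators
open MeasureTheory Set
open Literature.NumberTheory.Transcendental Literature.NumberTheory.Transcendental.KZ

namespace Summit.KontsevichZagierPeriods.KontsevichZagierPeriods.Theorems

/-! ### The three dimensionwise predicates -/

/-- **PRES-RAT(n).** Every rational integral representation of dimension `n` (KZ's literal
shape) is presentable: a positive multiple of it is KZ-equivalent to an integer combination of
cube integrals of real parts of cube germs. [this work] -/
def SoloInformedPresRat (n : ℕ) : Prop :=
  ∀ r : IntegralRep n, r.IsRational → of r ∈ soloInformedPresentable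

/-- **PRES(n).** Every integral representation of dimension `n` is presentable. [this work] -/
def SoloInformedPresAll (n : ℕ) : Prop :=
  ∀ r : IntegralRep n, of r ∈ soloInformedPresentable

/-- **CUBE(n).** Every integral representation with domain the unit cube `[0,1]ⁿ` is presentable:
the dimension-`n` slice of the cube crux (`SoloInformedAyoubCubeResolutionCube` of file
`SoloInformedCubeCrux`). [this work] -/
def SoloInformedCubeDim (n : ℕ) : Prop :=
  ∀ r : IntegralRep n, r.domain = soloInformedCube n → of r ∈ soloInformedPresentable

/-! ### The ladder -/

/-- PRES(n) ⇒ PRES-RAT(n). -/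
theorem soloInformed_presRat_of_presAll {n : ℕ} (h : SoloInformedPresAll n) :
    SoloInformedPresRat n :=
  fun r _ => h r

/-- PRES(n) ⇒ CUBE(n). -/
theorem soloInformed_cubeDim_of_presAll {n : ℕ} (h : SoloInformedPresAll n) :
    SoloInformedCubeDim n :=
  fun r _ => h r

/-- **CUBE(n) ⇒ PRES(n)** by THEOREM B′ (`soloInformed_kzUnitCube`): every representation is
KZ-equivalent to a sum of representations of the same dimension with domain the unit cube.
[Kontsevich–Zagier 2001, §1.2] -/
theorem soloInformed_presAll_of_cubeDim {n : ℕ} (h : SoloInformedCubeDim n) :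
    SoloInformedPresAll n := by
  intro r
  obtain ⟨M, rs, hdom, hrel⟩ := soloInformed_kzUnitCube r
  exact soloInformed_presentable_of_sub_mem hrel
    (soloInformed_presentable_sum _ _ fun k _ => h (rs k) (hdom k))

/-- CUBE(n) ⇔ PRES(n). -/
theorem soloInformed_cubeDim_iff_presAll {n : ℕ} : SoloInformedCubeDim n ↔ SoloInformedPresAll n :=
  ⟨soloInformed_presAll_of_cubeDim, soloInformed_cubeDim_of_presAll⟩

/-- **PRES-RAT(n+1) ⇒ PRES(n)**: a representation of dimension `n` is KZ-equivalent (one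
Newton–Leibniz move) to its volume-under-the-graph representation, which is rational of dimension
`n + 1` (`KZ.IntegralRep.graphRep`). [Kontsevich–Zagier 2001, §1.1, remark after the Definition] -/
theorem soloInformed_presAll_of_presRat_succ {n : ℕ} (h : SoloInformedPresRat (n + 1)) :
    SoloInformedPresAll n := by
  intro r
  have hTS : Literature.ModelTheory.ExponentialFields.tarski_seidenberg_real (k := ℚ) :=
    Literature.ModelTheory.ExponentialFields.tarski_seidenberg_real_holds
  exact soloInformed_presentable_of_sub_mem (r.equivalent_graphRep hTS)
    (h _ (r.isRational_graphRep hTS))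

/-- PRES-RAT(n+1) ⇒ PRES-RAT(n) (the ladder is monotone). -/
theorem soloInformed_presRat_of_presRat_succ {n : ℕ} (h : SoloInformedPresRat (n + 1)) :
    SoloInformedPresRat n :=
  soloInformed_presRat_of_presAll (soloInformed_presAll_of_presRat_succ h)

/-- PRES-RAT(N) ⇒ PRES-RAT(n) for all `n ≤ N`. -/
theorem soloInformed_presRat_of_le {n N : ℕ} (hnN : n ≤ N) (h : SoloInformedPresRat N) :
    SoloInformedPresRat n := by
  induction N, hnN using Nat.le_induction with
  | base => exact h
  | succ N _ ih => exact ih (soloInformed_presRat_of_presRat_succ h)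

/-- **The open input of the transfer is `∀ n, PRES(n)`.** -/
theorem soloInformed_cubeResolution_iff_forall_presAll :
    SoloInformedAyoubCubeResolution ↔ ∀ n, SoloInformedPresAll n := by
  constructor
  · intro h n r
    obtain ⟨k, hk, m, d, G, c, ρ, hd, hI, hrel⟩ := h n r
    exact soloInformed_mem_presentable_iff.2 ⟨k, hk, Fin m, inferInstance, d, G, c, ρ, hd, hI, hrel⟩
  · intro h n r
    obtain ⟨k, hk, m, d, G, c, ρ, hd, hI, hrel⟩ := soloInformed_exists_fin_of_presentable (h n r)
    exact ⟨k, hk, m, d, G, c, ρ, hd, hI, hrel⟩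

/-- … and `∀ n, CUBE(n)` (THEOREM B′). -/
theorem soloInformed_cubeResolution_iff_forall_cubeDim :
    SoloInformedAyoubCubeResolution ↔ ∀ n, SoloInformedCubeDim n := by
  rw [soloInformed_cubeResolution_iff_forall_presAll]
  exact ⟨fun h n => soloInformed_cubeDim_of_presAll (h n),
    fun h n => soloInformed_presAll_of_cubeDim (h n)⟩

/-- **`∀ n, PRES-RAT(n)` is the open input of the transfer**: globally the rational refinement
loses and gains nothing; its content is dimensionwise. -/
theorem soloInformed_forall_presRat_iff_cubeResolution :
    (∀ n, SoloInformedPresRat n) ↔ SoloInformedAyoubCubeResolution := by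
  rw [soloInformed_cubeResolution_iff_forall_presAll]
  exact ⟨fun h n => soloInformed_presAll_of_presRat_succ (h _),
    fun h n => soloInformed_presRat_of_presAll (h n)⟩

/-! ### The two-representation core of the Ayoub transfer -/

/-- A presentable representation has a presentation datum in the `Fin`-indexed Ayoub-generator
shape of THEOREM P_A (flatten the cube germs into Ayoub generators by
`soloInformed_cubePresentation_of_germ`). -/
theorem soloInformed_ayoubDatum_of_presentable {n : ℕ} {r : IntegralRep n}
    (hx : of r ∈ soloInformedPresentable) :
    ∃ (k : ℕ) (_ : k ≠ 0) (m : ℕ) (d : Fin m → ℕ)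
      (a : ∀ j, SoloInformedAyoubGen (d j)) (c : Fin m → ℤ) (ρ : ∀ j, IntegralRep (d j)),
      (∀ j, (ρ j).domain = soloInformedCube (d j)) ∧
      (∀ j, EqOn (ρ j).integrand (fun x => ((a j).f (soloInformedToC (d j) x)).re)
        (soloInformedCube (d j))) ∧
      k • of r - ∑ j, c j • of (ρ j) ∈ relations := by
  obtain ⟨k, hk, m, d, G, c, ρ, hd, hI, hrel⟩ := soloInformed_exists_fin_of_presentable hx
  choose mj aj ρj hdj hIj hrelj using
    fun j => soloInformed_cubePresentation_of_germ (G j) (ρ j) (hd j) (hI j)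
  let σ : Fin (∑ j, mj j) ≃ (Σ j : Fin m, Fin (mj j)) := finSigmaFinEquiv.symm
  refine ⟨k, hk, ∑ j, mj j, fun i => d (σ i).1, fun i => aj (σ i).1 (σ i).2,
    fun i => c (σ i).1, fun i => ρj (σ i).1 (σ i).2, fun i => hdj _ _, fun i => hIj _ _, ?_⟩
  have hsum : ∑ i, c (σ i).1 • of (ρj (σ i).1 (σ i).2) =
      ∑ j, c j • ∑ i, of (ρj j i) := by
    rw [σ.sum_comp (fun p : Σ j : Fin m, Fin (mj j) => c p.1 • of (ρj p.1 p.2)),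
      Fintype.sum_sigma]
    exact Finset.sum_congr rfl fun j _ => by
      dsimp only
      rw [Finset.smul_sum]
  rw [hsum, show k • of r - ∑ j, c j • ∑ i, of (ρj j i) =
    (k • of r - ∑ j, c j • of (ρ j)) + ∑ j, c j • (of (ρ j) - ∑ i, of (ρj j i)) by
      simp only [smul_sub, Finset.sum_sub_distrib]; abel]
  exact relations.add_mem hrel (relations.sum_mem fun j _ => relations.zsmul_mem (hrelj j) _)

/-- **Two presentable representations with the same value are KZ-equivalent, given Ayoub's
conjecture up to torsion.**  The proof of `soloInformed_ayoubTransferQ` run on the two given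
representations only: LEMMA Q (`soloInformed_ayoubLemmaQ`) realises the two presentations in
Ayoub's algebra, the values agree, Ayoub's conjecture up to torsion makes a multiple of the
difference an Ayoub relation, LEMMA Q maps it into `KZ.relations`, and FACT M (saturation,
`soloInformed_equivalent_of_nsmul_sub_mem`) removes the multiple.
[Ayoub 2014, §2.2, Conj. 7, Prop. 11, Rem. 13] -/
theorem soloInformed_equivalent_of_presentable (hA : SoloInformedAyoubKZeffQ) {n n' : ℕ}
    {r : IntegralRep n} {r' : IntegralRep n'} (hr : of r ∈ soloInformedPresentable)
    (hr' : of r' ∈ soloInformedPresentable) (hv : r.value = r'.value) : Equivalent r r' := by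
  have hQ : SoloInformedAyoubLemmaQ := soloInformed_ayoubLemmaQ
  obtain ⟨k, hk, m, d, a, c, ρ, hρd, hρi, hrel⟩ := soloInformed_ayoubDatum_of_presentable hr
  obtain ⟨k', hk', m', d', a', c', ρ', hρd', hρi', hrel'⟩ :=
    soloInformed_ayoubDatum_of_presentable hr'
  set x : SoloInformedAyoubSymbols := ∑ j, c j • soloInformedAyoubOf (a j) with hx
  set x' : SoloInformedAyoubSymbols := ∑ j, c' j • soloInformedAyoubOf (a' j) with hx'
  have hψ : soloInformedAyoubPsi hQ x - k • of r ∈ relations :=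
    soloInformedAyoubPsi_presentation hQ r a c ρ hρd hρi hrel
  have hψ' : soloInformedAyoubPsi hQ x' - k' • of r' ∈ relations :=
    soloInformedAyoubPsi_presentation hQ r' a' c' ρ' hρd' hρi' hrel'
  have hre := soloInformedAyoubEv_re_eq hQ r k x hψ
  have hre' := soloInformedAyoubEv_re_eq hQ r' k' x' hψ'
  have him : (soloInformedAyoubEv x).im = 0 := soloInformedAyoubEv_sum_im hQ a c
  have him' : (soloInformedAyoubEv x').im = 0 := soloInformedAyoubEv_sum_im hQ a' c'
  have hy : soloInformedAyoubEv (k' • x - k • x') = 0 := by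
    apply Complex.ext
    · rw [map_sub, map_nsmul, map_nsmul, nsmul_eq_mul, nsmul_eq_mul, Complex.sub_re,
        Complex.mul_re, Complex.mul_re, hre, hre', him, him', hv]
      simp only [Complex.natCast_re, Complex.natCast_im, zero_mul, sub_zero, Complex.zero_re]
      ring
    · rw [map_sub, map_nsmul, map_nsmul, nsmul_eq_mul, nsmul_eq_mul, Complex.sub_im,
        Complex.mul_im, Complex.mul_im, hre, hre', him, him']
      simp
  obtain ⟨N, hN, hNy⟩ := hA _ hy
  have hΨy : soloInformedAyoubPsi hQ (N • (k' • x - k • x')) ∈ relations :=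
    soloInformedAyoubPsi_rel hQ hNy
  have e2 : soloInformedAyoubPsi hQ (N • (k' • x - k • x')) =
      N • (k' • soloInformedAyoubPsi hQ x - k • soloInformedAyoubPsi hQ x') := by
    simp only [map_nsmul, map_sub]
  have hkk : (N * (k * k')) • (of r - of r') ∈ relations := by
    rw [soloInformed_smul_identity (soloInformedAyoubPsi hQ x) (soloInformedAyoubPsi hQ x')
      (of r) (of r') N k k', ← e2]
    exact relations.add_mem (relations.sub_mem hΨy (relations.nsmul_mem hψ _))
      (relations.nsmul_mem hψ' _)
  exact soloInformed_equivalent_of_nsmul_sub_mem (mul_ne_zero hN (mul_ne_zero hk hk')) hkk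

/-! ### The transfer from PRES-RAT, and its truncations -/

/-- **The Ayoub transfer from presentability of rational representations**: `∀ n, PRES-RAT(n)`
and Ayoub's conjecture up to torsion imply the Kontsevich–Zagier period conjecture.
[Ayoub 2014, §2.2, Conj. 7, Prop. 11, Rem. 13] -/
theorem soloInformed_ayoubTransferRat (hP : ∀ n, SoloInformedPresRat n)
    (hA : SoloInformedAyoubKZeffQ) : KontsevichZagierPeriods :=
  KontsevichZagierPeriods_iff.2 fun n n' r r' hr hr' hv =>
    soloInformed_equivalent_of_presentable hA (hP n r hr) (hP n' r' hr') hv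

/-- **The period conjecture for representations of dimension at most `N`**: any two rational
integral representations of dimensions `≤ N` with the same value are KZ-equivalent (the
intermediate representations of the chain of moves may have any dimension). [this work] -/
def SoloInformedKZPUpTo (N : ℕ) : Prop :=
  ∀ ⦃n m : ℕ⦄ (r : IntegralRep n) (r' : IntegralRep m), n ≤ N → m ≤ N →
    r.IsRational → r'.IsRational → r.value = r'.value → Equivalent r r'

/-- The summit is the conjunction of its truncations. -/
theorem soloInformed_kzp_iff_forall_kzpUpTo :
    KontsevichZagierPeriods ↔ ∀ N, SoloInformedKZPUpTo N := by
  rw [KontsevichZagierPeriods_iff]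
  exact ⟨fun h N n m r r' _ _ hr hr' hv => h r r' hr hr' hv,
    fun h n m r r' hr hr' hv => h (max n m) r r' (le_max_left n m) (le_max_right n m) hr hr' hv⟩

/-- The truncations are monotone in `N`. -/
theorem soloInformed_kzpUpTo_mono {N N' : ℕ} (hNN' : N ≤ N') (h : SoloInformedKZPUpTo N') :
    SoloInformedKZPUpTo N :=
  fun _ _ r r' hn hm => h r r' (hn.trans hNN') (hm.trans hNN')

/-- **Truncated transfer**: PRES-RAT in dimensions `≤ N` and Ayoub's conjecture up to torsion give
the period conjecture for rational representations of dimensions `≤ N`. By monotonicity of the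
ladder (`soloInformed_presRat_of_le`) the hypothesis is just PRES-RAT(N).
[Ayoub 2014, §2.2, Conj. 7, Prop. 11, Rem. 13] -/
theorem soloInformed_kzpUpTo_of_presRat {N : ℕ} (hP : SoloInformedPresRat N)
    (hA : SoloInformedAyoubKZeffQ) : SoloInformedKZPUpTo N :=
  fun _ _ r r' hn hm hr hr' hv =>
    soloInformed_equivalent_of_presentable hA (soloInformed_presRat_of_le hn hP r hr)
      (soloInformed_presRat_of_le hm hP r' hr') hv

/- The transfer from the cube resolution is already `soloInformed_ayoubTransfer₄`
(`SoloInformedCubeResolution`); by `soloInformed_forall_presRat_iff_cubeResolution` it factors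
through `soloInformed_ayoubTransferRat`. -/

end Summit.KontsevichZagierPeriods.KontsevichZagierPeriods.Theorems
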